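/-
Copyright (c) 2026 Gabriel Dahia. All rights reserved.
Released under Apache 2.0 license as described in the file LICENSE.
Authors: Gabriel Dahia

Ported into this library from `DensityHalesJewett/FiniteUnions.lean` of
github.com/gdahia/DensityHalesJewett @ 27e0e64 (Apache-2.0): the namespace `DensityHalesJewett`
becomes `Literature.Combinatorics.HalesJewett`, module names are flattened and docstrings
carry provenance tags; the mathematics is unchanged.
-/
import Mathlib.Combinatorics.HalesJewett
import Mathlib.Combinatorics.Pigeonhole
import Mathlib.Data.Finset.Sort
import HarnessLib

/-!
# Finite unions of disjoint sets from the multidimensional Hales--Jewett theorem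

For a colouring of the subsets of a large finite index set we produce pairwise disjoint nonempty
blocks all of whose nonempty unions receive the same colour (the finite union theorem, Folkman;
Prömel 2013, Thm 5.7, there obtained from the Graham--Rothschild theorem).  The argument here is
the direct one from the multidimensional Hales--Jewett theorem (Mathlib's
`Combinatorics.Subspace.exists_mono_in_high_dimension_fin`): the multidimensional Hales--Jewett
theorem over the alphabet `Bool` gives a translated combinatorial cube of sets, iterating it
canonizes the colour of a union in terms of its least block, and the pigeonhole principle
extracts a monochromatic family.

## Source of the formalization

This file is a port (namespace, imports and docstring tags only; proofs unchanged) of the file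
`DensityHalesJewett/FiniteUnions.lean`
of the Apache-2.0 Lean 4 development github.com/gdahia/DensityHalesJewett @ 27e0e64 (G. Dahia 2026),
a formalization of Dodos–Kanellopoulos–Tyros, *A simple proof of the density Hales–Jewett
theorem* (IMRN 2014).
Paper locators in the tags refer to that article (arXiv:1209.4986 numbering: Thm 1, Prop. 2–3,
Lemma 4, Cor. 5, Prop. 6, Lemmas 7–8, Def. 9, Lemma 10, Cor. 11, Lemma 12, Cor. 13).
Status (2026-08-15): of this port the tree holds `Word`, `Subspace`, `FiniteUnions`, `Canonization`,
`GrahamRothschild` and `Insensitive` (this directory). The density Hales–Jewett theorem itself was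
completed in the tree by the parallel development `DKTSubspaces` / `DKTCorrelation` /
`DensityHalesJewettProofs` (`DensityHalesJewett_holds`; it builds on `Word.lean` and `Subspace.lean`
of this port), and Szemerédi's theorem is discharged as
`Literature.Combinatorics.Additive.SzemerediTheorem_holds` in
`NumberTheory/Sieve/ParityWave0GreenTaoHolds.lean`; the remaining upstream files (`UniformFibers`,
the tilings of `Insensitive`, `DensityIncrement/…`, `Main`) were therefore not ported.

## References
* P. Dodos, V. Kanellopoulos, K. Tyros, *A simple proof of the density Hales–Jewett theorem*,
  IMRN 2014 (12), 3340–3352, arXiv:1209.4986. [cite: DodosKanellopoulosTyros2014]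
* H. Furstenberg, Y. Katznelson, *A density version of the Hales–Jewett theorem*, J. Anal. Math. 57
  (1991), 64–119 — the theorem. [cite: FurstenbergKatznelson1991]
* D. H. J. Polymath, *A new proof of the density Hales–Jewett theorem*, Ann. of Math. 175 (2012),
  1283–1327. [cite: Polymath2012DHJ]
* H. J. Prömel, *Ramsey Theory for Discrete Structures*, Springer 2013, Thm 5.1
  (Graham–Rothschild), Thm 5.7 (finite union theorem). [cite: Promel2013]
-/

open Finset
open Combinatorics

namespace Literature.Combinatorics.HalesJewett
namespace FiniteUnions

/-- A translated combinatorial cube of sets: a base block `E` and wildcard blocks `G` such that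
every union of `E` with a subfamily of the `G` has the same colour. [folklore] -/
lemma exists_translatedCube (C : Type*) [Finite C] (n : ℕ) :
    ∃ M : ℕ, ∀ d : Finset (Fin M) → C,
      ∃ (E : Finset (Fin M)) (G : Fin n → Finset (Fin M)),
        E.Nonempty ∧ (∀ i, (G i).Nonempty) ∧ (∀ i, Disjoint E (G i)) ∧
          (∀ i j, i ≠ j → Disjoint (G i) (G j)) ∧
          ∃ c, ∀ I : Finset (Fin n), d (E ∪ I.biUnion G) = c := by
  classical
  obtain ⟨M, hM⟩ := Combinatorics.Subspace.exists_mono_in_high_dimension_fin Bool C (Fin (n + 1))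
  refine ⟨M, ?_⟩
  intro d
  obtain ⟨W, c, hc⟩ := hM fun x ↦ d {i | x i}
  set S : Finset (Fin M) := {i | W.idxFun i = Sum.inl true} with hS
  set X : Fin (n + 1) → Finset (Fin M) := fun j ↦ {i | W.idxFun i = Sum.inr j} with hX
  have hXne : ∀ j, (X j).Nonempty := by
    intro j
    obtain ⟨i, hi⟩ := W.proper j
    exact ⟨i, by simp [hX, hi]⟩
  have hXX : ∀ j j', j ≠ j' → Disjoint (X j) (X j') := by
    simp only [Finset.disjoint_left, hX, Finset.mem_filter, Finset.mem_univ, true_and]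
    grind
  have hSX : ∀ j, Disjoint S (X j) := by
    simp only [Finset.disjoint_left, hS, hX, Finset.mem_filter, Finset.mem_univ, true_and]
    grind
  have key : ∀ J : Finset (Fin (n + 1)), d (S ∪ J.biUnion X) = c := by
    intro J
    rw [← hc fun j ↦ decide (j ∈ J)]
    congr 1
    ext i
    simp only [hS, hX, Finset.mem_filter, Finset.mem_univ, true_and, Finset.mem_union,
      Finset.mem_biUnion]
    rw [Combinatorics.Subspace.coe_apply]
    cases h : W.idxFun i with
    | inl b => cases b <;> simp
    | inr j => simp
  refine ⟨S ∪ X 0, fun i ↦ X i.succ, (hXne 0).mono Finset.subset_union_right,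
    fun i ↦ hXne _, ?_, fun i j hij ↦ hXX _ _ fun h ↦ hij (Fin.succ_injective _ h),
    c, ?_⟩
  · intro i
    exact Finset.disjoint_union_left.2 ⟨hSX _, hXX _ _ (Fin.succ_ne_zero i).symm⟩
  · intro I
    convert key (insert 0 (I.image Fin.succ)) using 2
    ext i
    simp only [Finset.mem_union, Finset.mem_biUnion, Finset.mem_insert, Finset.mem_image]
    grind

/-- Iterating the translated cube canonizes the colour of a union of blocks in terms of the least
block that it contains. [folklore] -/
lemma exists_minCanonical (C : Type*) [Finite C] (t : ℕ) :
    ∃ D : ℕ, ∀ d : Finset (Fin D) → C, ∃ E : Fin t → Finset (Fin D),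
      (∀ i, (E i).Nonempty) ∧ (∀ i j, i ≠ j → Disjoint (E i) (E j)) ∧
        ∃ f : Fin t → C, ∀ (J : Finset (Fin t)) (hJ : J.Nonempty),
          d (J.biUnion E) = f (J.min' hJ) := by
  classical
  induction t with
  | zero =>
    refine ⟨0, ?_⟩
    intro d
    refine ⟨Fin.elim0, fun i ↦ i.elim0, fun i ↦ i.elim0, Fin.elim0, ?_⟩
    intro J hJ
    simp [Finset.eq_empty_of_isEmpty J] at hJ
  | succ t ih =>
    obtain ⟨D, hD⟩ := ih
    obtain ⟨M, hM⟩ := exists_translatedCube C D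
    refine ⟨M, ?_⟩
    intro d
    obtain ⟨E₀, G, hE₀, hG, hE₀G, hGG, c, hc⟩ := hM d
    obtain ⟨I, hI, hII, f, hf⟩ := hD fun K ↦ d (K.biUnion G)
    refine ⟨Fin.cons E₀ fun j ↦ (I j).biUnion G, ?_, ?_, Fin.cons c f, ?_⟩
    · intro i
      induction i using Fin.cases with
      | zero => simpa using hE₀
      | succ j => simpa using (hI j).biUnion fun g _ ↦ hG g
    · intro i j hij
      induction i using Fin.cases with
      | zero =>
        induction j using Fin.cases with
        | zero => exact absurd rfl hij
        | succ j =>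
          simpa using (Finset.disjoint_biUnion_right _ _ _).2 fun g _ ↦ hE₀G g
      | succ i =>
        induction j using Fin.cases with
        | zero =>
          simpa using
            (Finset.disjoint_biUnion_left _ _ _).2 fun g _ ↦ (hE₀G g).symm
        | succ j =>
          simp only [Fin.cons_succ, Finset.disjoint_biUnion_left, Finset.disjoint_biUnion_right]
          intro g hg g' hg'
          apply hGG g' g
          intro hgg'
          refine (hII i j ?_).notMem_of_mem_left_finset hg' (hgg' ▸ hg)
          intro h
          exact hij (congrArg Fin.succ h)
    · intro J hJ
      set K : Finset (Fin t) := {j | j.succ ∈ J} with hK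
      have himage : J.erase 0 = K.image Fin.succ := by
        ext i
        induction i using Fin.cases with
        | zero => simp
        | succ j => simp [hK, Fin.succ_ne_zero]
      have hbiUnion : (J.erase 0).biUnion (Fin.cons E₀ fun j ↦ (I j).biUnion G)
          = (K.biUnion I).biUnion G := by
        simp [himage, Finset.image_biUnion, Finset.biUnion_biUnion]
      by_cases h0 : (0 : Fin (t + 1)) ∈ J
      · have hmin : J.min' hJ = 0 := le_antisymm (Finset.min'_le _ _ h0) (Fin.zero_le _)
        rw [hmin, ← Finset.insert_erase h0, Finset.biUnion_insert, hbiUnion]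
        simpa using hc _
      · have hKne : K.Nonempty := by
          obtain ⟨i, hi⟩ := hJ
          induction i using Fin.cases with
          | zero => exact absurd hi h0
          | succ j => exact ⟨j, by simpa [hK] using hi⟩
        have hJK : J = K.image Fin.succ := by rw [← himage, Finset.erase_eq_of_notMem h0]
        have hmin : J.min' hJ = (K.min' hKne).succ := by
          simp_rw [hJK]
          exact Finset.min'_image (fun _ _ h ↦ Fin.succ_le_succ_iff.2 h) K _
        rw [hmin, ← Finset.erase_eq_of_notMem h0, hbiUnion]
        simpa using hf K hKne

/-- The finite disjoint unions theorem: for every colouring of the subsets of a large enough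
finite index set there are `m` pairwise disjoint nonempty blocks all of whose nonempty unions
receive the same colour. [cite: Promel2013, Thm 5.7 (finite union theorem)] -/
lemma exists_monochromaticUnions (C : Type*) [Finite C] (m : ℕ) :
    ∃ D : ℕ, ∀ d : Finset (Fin D) → C, ∃ E : Fin m → Finset (Fin D),
      (∀ i, (E i).Nonempty) ∧ (∀ i j, i ≠ j → Disjoint (E i) (E j)) ∧
        ∃ c, ∀ J : Finset (Fin m), J.Nonempty → d (J.biUnion E) = c := by
  classical
  let _ := Fintype.ofFinite C
  obtain ⟨D, hD⟩ := exists_minCanonical C ((m - 1) * Fintype.card C + 1)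
  refine ⟨D, ?_⟩
  intro d
  obtain ⟨E, hE, hEE, f, hf⟩ := hD d
  obtain ⟨c, -, hcard⟩ :=
    Finset.exists_lt_card_fiber_of_mul_lt_card_of_maps_to (s := Finset.univ)
      (t := (Finset.univ : Finset C)) (f := f) (n := m - 1) (fun a _ ↦ Finset.mem_univ _) (by
        simp only [Finset.card_univ, Fintype.card_fin]
        rw [Nat.mul_comm]
        omega)
  obtain ⟨T, hTsub, hTcard⟩ :=
    Finset.exists_subset_card_eq (s := {i | f i = c}) (n := m) (by omega)
  refine ⟨fun j ↦ E (T.orderEmbOfFin hTcard j), fun j ↦ hE _,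
    fun i j hij ↦ hEE _ _ fun h ↦ hij ((T.orderEmbOfFin hTcard).injective h), c, ?_⟩
  intro J hJ
  rw [← Finset.image_biUnion, hf _ (hJ.image _)]
  obtain ⟨j, -, hj⟩ :=
    Finset.mem_image.1 (Finset.min'_mem _ (hJ.image (T.orderEmbOfFin hTcard)))
  rw [← hj]
  simpa using hTsub (T.orderEmbOfFin_mem hTcard j)

end FiniteUnions
end Literature.Combinatorics.HalesJewett
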